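import Literature.AlgebraicGeometry.Pohlmann1968.HodgeClassesProductSpanCMProducts
import HarnessLib

/-!
# Hodge classes on `X × Y` for CM products `X`, `Y`: the product-span property from BLOCK SPLITTING of balanced weights

Family `hodge`, layer `Literature/AlgebraicGeometry/Pohlmann1968`; cell `pub-hodgecm2` (COR-CM), count-neutral own-lane
sequel of `Pohlmann1968/HodgeClassesProductSpanCMProducts` (`hodgeClassesProductSpan_biproduct_of_blockwiseIndependent`).
That theorem runs Pohlmann's theorem for a CM algebra on `X × Y` (`X = ⨁ A_i`, `Y = ⨁ A'_j` products of realisations of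
CM types `Φ_i` of `K_i`, `Φ'_j` of `K'_j`) and uses its hypothesis — blockwise independent `Aut(ℂ)`-action on the embeddings —
at exactly ONE point: to split every weight `S ⊆ (⊔_i Hom(K_i,ℂ)) ⊔ (⊔_j Hom(K'_j,ℂ))` that is balanced for the glued CM pair
`(∏ K_i × ∏ K'_j, Φ ⊔ Φ')` into balanced blocks `S.toLeft ∈ pohlmannSetsAlg Φ p₁`, `S.toRight ∈ pohlmannSetsAlg Φ' p₂`
(`exists_pohlmannSetsAlg_toLeft_toRight`).  This file records the engine with that splitting property ITSELF as the hypothesis: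

* **`hodgeClassesProductSpan_biproduct_of_blocksSplit`** — if every glued-balanced weight splits into balanced blocks, then
  `HodgeTheory.HodgeClassesProductSpan (⨁ A) (⨁ A')`: every rational Hodge class on `X × Y` is a `ℂ`-combination of exterior
  products `pr_X^* a ∪ pr_Y^* b` of rational Hodge classes of the factors.

The splitting property is the exact weight-by-weight content of Moonen–Zarhin's criterion (3.1) `Hg(X × Y) = Hg(X) × Hg(Y)`
(every invariant line of `Hg(X × Y)` in `H^•(X) ⊗ H^•(Y)` is a product of invariant lines of the factors); it holds under
blockwise independence (the first file) and, more generally, under RANK ADDITIVITY `rank(Φ ⊔ Φ') + 1 = rank Φ + rank Φ'` of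
the CM families (`NumberTheory/ComplexMultiplication/CMTypeRankTwoBlocks`, consumed in
`Pohlmann1968/HodgeClassesProductSpanCMProductsRank`).  PROOF: word for word the proof of the first file (module docstring
there: separating pair, eigenbases, Künneth basis of `H¹(X × Y)` on the lexicographic sum, monomial basis, the `⊆` half of
Pohlmann's engine `mem_span_monomials_of_isRationalClass`, block splitting, `u_s = pr_X^* w_{s₁} ∪ pr_Y^* w'_{s₂}`, Pohlmann's
theorem for `X` and `Y`, bilinearity), with step (5) supplied by the hypothesis.  Theorems only; no definition, no named fact;
axioms `propext`, `Classical.choice`, `Quot.sound`.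

## References
* [MoonenZarhin1999LowDim] B. Moonen, Yu. Zarhin, Math. Ann. 315 (1999) 711–733, §3 (3.1), Cor. (3.9).
* [Gordon1999HodgeAVSurvey] B. B. Gordon, *A survey of the Hodge conjecture for abelian varieties*, §3 Theorem (Imai,
  Murty) with proof, 7.5–7.7; §9.2.
* [GaoUllmo2025] Z. Gao, E. Ullmo, J. Inst. Math. Jussieu 25 (2025), §2.1 and Thm. 3.1 (Pohlmann for a CM algebra).
* [Pohlmann1968] H. Pohlmann, Ann. of Math. 88 (1968) 161–180, Thm. 1.
-/

noncomputable section

open CategoryTheory CategoryTheory.Limits NumberField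

namespace Literature.AlgebraicGeometry.Pohlmann1968

open Module
open Literature.AlgebraicTopology.SingularHomology
open Literature.AlgebraicGeometry.Motives (AbelianVariety CMType IsSmoothProjective ComplexPoints)
open Literature.AlgebraicGeometry.HodgeTheory
open Literature.AlgebraicGeometry.ComplexMultiplication (IsCMTypeRealisation)
open Literature.AlgebraicGeometry.VanGeemen1994 (hodgeClassSpan)

/-! ### Private book-keeping: enumerations on `α ⊕ₗ β`, counting, bilinearity -/

/-- In the lexicographic sum order `α ⊕ₗ β` (first block before second block), the increasing enumeration of a
finite `s` lists the first block `{a | inl a ∈ s}` increasingly and then the second block `{b | inr b ∈ s}`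
increasingly (uniqueness of increasing enumerations, `Finset.orderEmbOfFin_unique`). [folklore] -/
private theorem orderEmbOfFin_sumLex_castAdd_natAdd {α β : Type*} [LinearOrder α] [LinearOrder β]
    (s : Finset (α ⊕ₗ β)) {d d₁ d₂ : ℕ} (hs : s.card = d)
    (h₁ : (s.map (ofLex : α ⊕ₗ β ≃ α ⊕ β).toEmbedding).toLeft.card = d₁)
    (h₂ : (s.map (ofLex : α ⊕ₗ β ≃ α ⊕ β).toEmbedding).toRight.card = d₂) (hd : d₁ + d₂ = d) :
    (∀ i : Fin d₁, s.orderEmbOfFin hs (Fin.cast hd (Fin.castAdd d₂ i)) =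
        toLex (Sum.inl ((s.map (ofLex : α ⊕ₗ β ≃ α ⊕ β).toEmbedding).toLeft.orderEmbOfFin h₁ i))) ∧
      ∀ j : Fin d₂, s.orderEmbOfFin hs (Fin.cast hd (Fin.natAdd d₁ j)) =
        toLex (Sum.inr ((s.map (ofLex : α ⊕ₗ β ≃ α ⊕ β).toEmbedding).toRight.orderEmbOfFin h₂ j)) := by
  classical
  have hmem : ∀ z : α ⊕ β, z ∈ s.map (ofLex : α ⊕ₗ β ≃ α ⊕ β).toEmbedding ↔ toLex z ∈ s := fun z => by
    rw [Finset.mem_map_equiv]; rfl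
  let f : Fin d → α ⊕ₗ β := fun k =>
    if hk : (k : ℕ) < d₁ then
      toLex (Sum.inl ((s.map (ofLex : α ⊕ₗ β ≃ α ⊕ β).toEmbedding).toLeft.orderEmbOfFin h₁ ⟨k, hk⟩))
    else toLex (Sum.inr ((s.map (ofLex : α ⊕ₗ β ≃ α ⊕ β).toEmbedding).toRight.orderEmbOfFin h₂
      ⟨k - d₁, by omega⟩))
  have hfs : ∀ k, f k ∈ s := by
    intro k
    by_cases hk : (k : ℕ) < d₁
    · simp only [f, hk, ↓reduceDIte]
      exact (hmem _).1 (Finset.mem_toLeft.1 (Finset.orderEmbOfFin_mem _ _ _))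
    · simp only [f, hk, ↓reduceDIte]
      exact (hmem _).1 (Finset.mem_toRight.1 (Finset.orderEmbOfFin_mem _ _ _))
  have hmono : StrictMono f := by
    intro k l hkl
    have hkl' : (k : ℕ) < l := hkl
    by_cases hl : (l : ℕ) < d₁
    · have hk : (k : ℕ) < d₁ := lt_trans hkl' hl
      simp only [f, hk, hl, ↓reduceDIte]
      exact Sum.Lex.inl_strictMono
        (((s.map (ofLex : α ⊕ₗ β ≃ α ⊕ β).toEmbedding).toLeft.orderEmbOfFin h₁).strictMono
          (Fin.mk_lt_mk.2 hkl'))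
    · by_cases hk : (k : ℕ) < d₁
      · simp only [f, hk, hl, ↓reduceDIte]
        exact Sum.Lex.inl_lt_inr _ _
      · simp only [f, hk, hl, ↓reduceDIte]
        exact Sum.Lex.inr_strictMono
          (((s.map (ofLex : α ⊕ₗ β ≃ α ⊕ β).toEmbedding).toRight.orderEmbOfFin h₂).strictMono
            (Fin.mk_lt_mk.2 (by omega)))
  have hf : f = s.orderEmbOfFin hs := Finset.orderEmbOfFin_unique hs hfs hmono
  refine ⟨fun i => ?_, fun j => ?_⟩
  · rw [← hf]
    have hi : ((Fin.cast hd (Fin.castAdd d₂ i) : Fin d) : ℕ) < d₁ := by simp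
    have hi' : (⟨((Fin.cast hd (Fin.castAdd d₂ i) : Fin d) : ℕ), hi⟩ : Fin d₁) = i := Fin.ext (by simp)
    simp only [f, hi, ↓reduceDIte, hi']
  · rw [← hf]
    have hj : ¬ ((Fin.cast hd (Fin.natAdd d₁ j) : Fin d) : ℕ) < d₁ := by simp
    have hj' : (⟨((Fin.cast hd (Fin.natAdd d₁ j) : Fin d) : ℕ) - d₁, by omega⟩ : Fin d₂) = j := Fin.ext (by simp)
    simp only [f, hj, ↓reduceDIte, hj']

/-- Counting the members of `s.map f` with a property = counting the members of `s` whose image has it.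
[folklore] -/
private theorem ncard_sep_map_eq {α β : Type*} (f : α ↪ β) (s : Finset α) (Q : β → Prop) :
    {i | i ∈ s.map f ∧ Q i}.ncard = {j | j ∈ s ∧ Q (f j)}.ncard := by
  rw [show {i | i ∈ s.map f ∧ Q i} = f '' {j | j ∈ s ∧ Q (f j)} by
      ext i
      simp only [Finset.mem_map, Set.mem_setOf_eq, Set.mem_image]
      constructor
      · rintro ⟨⟨j, hj, rfl⟩, hQ⟩; exact ⟨j, ⟨hj, hQ⟩, rfl⟩
      · rintro ⟨j, ⟨hj, hQ⟩, rfl⟩; exact ⟨⟨j, hj, rfl⟩, hQ⟩,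
    Set.ncard_image_of_injective _ f.injective]

section Main

variable {n m : ℕ} {K : Fin n → Type} {K' : Fin m → Type}
  [∀ i, Field (K i)] [∀ i, NumberField (K i)] [∀ j, Field (K' j)] [∀ j, NumberField (K' j)]
  {Φ : ∀ i, CMType (K i)} {Φ' : ∀ j, CMType (K' j)}
  {A : Fin n → AbelianVariety ℂ} {A' : Fin m → AbelianVariety ℂ}
  {ι : ∀ i, 𝓞 (K i) →+* End (A i)} {ι' : ∀ j, 𝓞 (K' j) →+* End (A' j)}
  {θ : ∀ i, K i →+* Module.End ℂ (complexBetti (A i).X 1)}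
  {θ' : ∀ j, K' j →+* Module.End ℂ (complexBetti (A' j).X 1)}

/-- **Hodge classes on `X × Y` are spanned by exterior products of Hodge classes of `X` and of `Y`, for CM products
`X = ⨁ A_i`, `Y = ⨁ A'_j` whose glued balanced weights split into balanced blocks.**  For realisations `(A_i, ι_i, θ_i)`
of CM types `Φ_i` of number fields `K_i` (`i < n`) and `(A'_j, ι'_j, θ'_j)` of `Φ'_j` of `K'_j` (`j < m`): if every weight
`S ⊆ (⊔_i Hom(K_i,ℂ)) ⊔ (⊔_j Hom(K'_j,ℂ))` satisfying Pohlmann's condition for the glued pair with value `p` (for every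
`τ ∈ Aut(ℂ)` exactly `p` members `(k, s)` of `S` have `τ ∘ s` inside the type and exactly `p` outside) has balanced blocks
`S.toLeft ∈ pohlmannSetsAlg Φ p₁`, `S.toRight ∈ pohlmannSetsAlg Φ' p₂`, `p₁ + p₂ = p` — the weight-by-weight form of
`Hg(X × Y) = Hg(X) × Hg(Y)` — then every rational `(p,p)`-class on `(⨁ A_i) × (⨁ A'_j)` is a `ℂ`-combination of classes
`pr₁^* a ∪ pr₂^* b`, `a`, `b` rational Hodge classes of the factors (`HodgeTheory.HodgeClassesProductSpan`).  Proof: module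
docstring. [cite: MoonenZarhin1999LowDim, §3 (3.1)] [cite: Gordon1999HodgeAVSurvey, §3 Theorem (Imai, Murty) with proof]
[cite: GaoUllmo2025, Thm. 3.1 with proof] -/
theorem hodgeClassesProductSpan_biproduct_of_blocksSplit
    (hA : ∀ i, IsCMTypeRealisation (Φ i) (A i) (ι i) (θ i))
    (hA' : ∀ j, IsCMTypeRealisation (Φ' j) (A' j) (ι' j) (θ' j))
    (hsplit : ∀ (S : Finset ((Σ i, (K i →+* ℂ)) ⊕ (Σ j, (K' j →+* ℂ)))) (p : ℕ),
      (∀ τ : ℂ ≃+* ℂ,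
        {z | z ∈ S ∧ Sum.elim (fun x : (Σ i, (K i →+* ℂ)) => (τ : ℂ →+* ℂ).comp x.2 ∈ (Φ x.1).1)
          (fun y : (Σ j, (K' j →+* ℂ)) => (τ : ℂ →+* ℂ).comp y.2 ∈ (Φ' y.1).1) z}.ncard = p ∧
        {z | z ∈ S ∧ ¬ Sum.elim (fun x : (Σ i, (K i →+* ℂ)) => (τ : ℂ →+* ℂ).comp x.2 ∈ (Φ x.1).1)
          (fun y : (Σ j, (K' j →+* ℂ)) => (τ : ℂ →+* ℂ).comp y.2 ∈ (Φ' y.1).1) z}.ncard = p) →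
      ∃ p₁ p₂ : ℕ, p₁ + p₂ = p ∧ S.toLeft ∈ pohlmannSetsAlg Φ p₁ ∧ S.toRight ∈ pohlmannSetsAlg Φ' p₂) :
    HodgeClassesProductSpan (⨁ A) (⨁ A') := by
  classical
  intro p c hcQ hcH
  have hX : IsSmoothProjective (⨁ A).dim (⨁ A).X := Motives.AbelianVariety.isSmoothProjective_holds
  have hY : IsSmoothProjective (⨁ A').dim (⨁ A').X := Motives.AbelianVariety.isSmoothProjective_holds
  have hZ : IsSmoothProjective ((⨁ A).prod (⨁ A')).dim ((⨁ A).prod (⨁ A')).X :=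
    Motives.AbelianVariety.isSmoothProjective_holds
  have hcH' : IsOfHodgeType ((⨁ A).prod (⨁ A')).dim ((⨁ A).prod (⨁ A')).X (2 * p) p p c := by
    rw [Motives.AbelianVariety.dim_prod]; exact hcH
  -- (1) separating pair, eigenbases of the factors, Künneth basis of `H¹(X × Y)`
  obtain ⟨a, a', haa⟩ := exists_separating_pair K K'
  have ha1 : ∀ i, Function.Injective fun σ : K i →+* ℂ => σ ((a i : 𝓞 (K i)) : K i) := by
    intro i σ σ' h
    have h' : ({Sum.inl ⟨i, σ⟩} : Finset ((Σ i, (K i →+* ℂ)) ⊕ (Σ j, (K' j →+* ℂ)))) = {Sum.inl ⟨i, σ'⟩} :=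
      haa (by simpa only [Finset.prod_singleton, Sum.elim_inl] using h)
    have h'' := Finset.singleton_injective h'
    exact eq_of_heq (Sigma.mk.inj_iff.1 (Sum.inl_injective h'')).2
  have ha1' : ∀ j, Function.Injective fun σ : K' j →+* ℂ => σ ((a' j : 𝓞 (K' j)) : K' j) := by
    intro j σ σ' h
    have h' : ({Sum.inr ⟨j, σ⟩} : Finset ((Σ i, (K i →+* ℂ)) ⊕ (Σ j, (K' j →+* ℂ)))) = {Sum.inr ⟨j, σ'⟩} :=
      haa (by simpa only [Finset.prod_singleton, Sum.elim_inr] using h)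
    have h'' := Finset.singleton_injective h'
    exact eq_of_heq (Sigma.mk.inj_iff.1 (Sum.inr_injective h'')).2
  choose v hv using fun i => exists_eigenbasis (hA i) (ha1 i)
  choose v' hv' using fun j => exists_eigenbasis (hA' j) (ha1' j)
  obtain ⟨w, hw⟩ := exists_biproductBasis_sigma A v
  obtain ⟨w', hw'⟩ := exists_biproductBasis_sigma A' v'
  have hvl : ∀ i σ, v i σ ∈ Literature.NumberTheory.Automorphic.PicardCM.eigenline (θ i) σ :=
    fun i σ => (Submodule.mem_iInf _).2 fun c => Module.End.mem_eigenspace_iff.2 (hv i σ c)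
  have hvl' : ∀ j σ, v' j σ ∈ Literature.NumberTheory.Automorphic.PicardCM.eigenline (θ' j) σ :=
    fun j σ => (Submodule.mem_iInf _).2 fun c => Module.End.mem_eigenspace_iff.2 (hv' j σ c)
  have hθ : ∀ (i : Fin n) (c : 𝓞 (K i)) (σ : K i →+* ℂ),
      complexBetti.map (ι i c).hom.hom.hom 1 (v i σ) = σ (c : K i) • v i σ := fun i c σ => by
    rw [show complexBetti.map (ι i c).hom.hom.hom 1 (v i σ) =
      (complexBetti.map (ι i c).hom.hom.hom 1).hom (v i σ) from rfl, (hA i).2.2.1 c]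
    exact hv i σ c
  have hθ' : ∀ (j : Fin m) (c : 𝓞 (K' j)) (σ : K' j →+* ℂ),
      complexBetti.map (ι' j c).hom.hom.hom 1 (v' j σ) = σ (c : K' j) • v' j σ := fun j c σ => by
    rw [show complexBetti.map (ι' j c).hom.hom.hom 1 (v' j σ) =
      (complexBetti.map (ι' j c).hom.hom.hom 1).hom (v' j σ) from rfl, (hA' j).2.2.1 c]
    exact hv' j σ c
  have hwθ : ∀ (c : ∀ i, 𝓞 (K i)) (x : (Σ i, (K i →+* ℂ))),
      complexBetti.map (biproduct.map fun i => ι i (c i)).hom.hom.hom 1 (w x) =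
        x.2 ((c x.1 : 𝓞 (K x.1)) : K x.1) • w x := fun c x => by
    rw [hw x, map_biproductMap_map_π, hθ, map_smul]
  have hwθ' : ∀ (c : ∀ j, 𝓞 (K' j)) (y : (Σ j, (K' j →+* ℂ))),
      complexBetti.map (biproduct.map fun j => ι' j (c j)).hom.hom.hom 1 (w' y) =
        y.2 ((c y.1 : 𝓞 (K' y.1)) : K' y.1) • w' y := fun c y => by
    rw [hw' y, map_biproductMap_map_π, hθ', map_smul]
  obtain ⟨u₀, hu₀l, hu₀r⟩ := exists_prodBasis_one (X := ⨁ A) (Y := ⨁ A') w w'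
  -- the index type `I = (⊔_i Hom(K_i, ℂ)) ⊕ₗ (⊔_j Hom(K'_j, ℂ))`, block orders first
  letI : LinearOrder (Σ i, (K i →+* ℂ)) :=
    LinearOrder.lift' (Fintype.equivFin (Σ i, (K i →+* ℂ))) (Fintype.equivFin (Σ i, (K i →+* ℂ))).injective
  letI : LinearOrder (Σ j, (K' j →+* ℂ)) :=
    LinearOrder.lift' (Fintype.equivFin (Σ j, (K' j →+* ℂ))) (Fintype.equivFin (Σ j, (K' j →+* ℂ))).injective
  have huex : ∃ u : Basis ((Σ i, (K i →+* ℂ)) ⊕ₗ (Σ j, (K' j →+* ℂ))) ℂ (complexBetti ((⨁ A).prod (⨁ A')).X 1),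
      (∀ x, u (toLex (Sum.inl x)) = complexBetti.map (AbelianVariety.fst (⨁ A) (⨁ A')).hom.hom.hom 1 (w x)) ∧
      ∀ y, u (toLex (Sum.inr y)) = complexBetti.map (AbelianVariety.snd (⨁ A) (⨁ A')).hom.hom.hom 1 (w' y) :=
    ⟨u₀.reindex (toLex (α := (Σ i, (K i →+* ℂ)) ⊕ (Σ j, (K' j →+* ℂ)))),
      fun x => by rw [Module.Basis.reindex_apply, toLex_symm_eq, ofLex_toLex, hu₀l],
      fun y => by rw [Module.Basis.reindex_apply, toLex_symm_eq, ofLex_toLex, hu₀r]⟩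
  obtain ⟨u, hul, hur⟩ := huex
  -- Hodge types of the `u`'s
  let P : (Σ i, (K i →+* ℂ)) ⊕ₗ (Σ j, (K' j →+* ℂ)) → Prop := fun z =>
    Sum.elim (fun x : (Σ i, (K i →+* ℂ)) => x.2 ∈ (Φ x.1).1)
      (fun y : (Σ j, (K' j →+* ℂ)) => y.2 ∈ (Φ' y.1).1) (ofLex z)
  have hv10 : ∀ z, P z → IsOfHodgeType ((⨁ A).prod (⨁ A')).dim ((⨁ A).prod (⨁ A')).X 1 1 0 (u z) := by
    intro z hz
    induction z using Lex.rec with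
    | h z =>
      rcases z with x | y
      · rw [hul x, hw x]
        exact ((((hA x.1).2.2.2 x.2).2.1 hz (v x.1 x.2) (hvl x.1 x.2)).map_of_isSmoothProjective hX
          (hA x.1).1 _).map_of_isSmoothProjective hZ hX _
      · rw [hur y, hw' y]
        exact ((((hA' y.1).2.2.2 y.2).2.1 hz (v' y.1 y.2) (hvl' y.1 y.2)).map_of_isSmoothProjective hY
          (hA' y.1).1 _).map_of_isSmoothProjective hZ hY _
  have hv01 : ∀ z, ¬ P z → IsOfHodgeType ((⨁ A).prod (⨁ A')).dim ((⨁ A).prod (⨁ A')).X 1 0 1 (u z) := by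
    intro z hz
    induction z using Lex.rec with
    | h z =>
      rcases z with x | y
      · rw [hul x, hw x]
        exact ((((hA x.1).2.2.2 x.2).2.2 hz (v x.1 x.2) (hvl x.1 x.2)).map_of_isSmoothProjective hX
          (hA x.1).1 _).map_of_isSmoothProjective hZ hX _
      · rw [hur y, hw' y]
        exact ((((hA' y.1).2.2.2 y.2).2.2 hz (v' y.1 y.2) (hvl' y.1 y.2)).map_of_isSmoothProjective hY
          (hA' y.1).1 _).map_of_isSmoothProjective hZ hY _
  -- (2) the monomial basis of `H^{2p}(X × Y)`
  obtain ⟨b, hb⟩ := exists_monomialBasis u (2 * p)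
  -- (3) Galois data on `X × Y`: the rational operator `(ι(a) × ι'(a'))^*`, eigenvalues, `Aut(ℂ)`
  let ev : (Σ i, (K i →+* ℂ)) ⊕ₗ (Σ j, (K' j →+* ℂ)) → ℂ := fun z =>
    Sum.elim (fun x : (Σ i, (K i →+* ℂ)) => x.2 ((a x.1 : 𝓞 (K x.1)) : K x.1))
      (fun y : (Σ j, (K' j →+* ℂ)) => y.2 ((a' y.1 : 𝓞 (K' y.1)) : K' y.1)) (ofLex z)
  have hf : ∀ z, complexBetti.map (AbelianVariety.prodMap (biproduct.map fun i => ι i (a i))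
      (biproduct.map fun j => ι' j (a' j))).hom.hom.hom 1 (u z) = (RingHom.id ℂ) (ev z) • u z := by
    intro z
    induction z using Lex.rec with
    | h z =>
      rcases z with x | y
      · rw [hul x, RingHom.id_apply]
        change singularCohomology.map ℂ ℂ _ 1 (singularCohomology.map ℂ ℂ _ 1 (w x)) = _
        rw [abelianVarietyHom_map_map_apply, AbelianVariety.prodMap_fst, ← abelianVarietyHom_map_map_apply]
        change complexBetti.map (AbelianVariety.fst (⨁ A) (⨁ A')).hom.hom.hom 1
          (complexBetti.map (biproduct.map fun i => ι i (a i)).hom.hom.hom 1 (w x)) = _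
        rw [hwθ a x, map_smul]
        rfl
      · rw [hur y, RingHom.id_apply]
        change singularCohomology.map ℂ ℂ _ 1 (singularCohomology.map ℂ ℂ _ 1 (w' y)) = _
        rw [abelianVarietyHom_map_map_apply, AbelianVariety.prodMap_snd, ← abelianVarietyHom_map_map_apply]
        change complexBetti.map (AbelianVariety.snd (⨁ A) (⨁ A')).hom.hom.hom 1
          (complexBetti.map (biproduct.map fun j => ι' j (a' j)).hom.hom.hom 1 (w' y)) = _
        rw [hwθ' a' y, map_smul]
        rfl
  have hinjc : ∀ (τ : ℂ ≃+* ℂ) {L : Type} [Field L],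
      Function.Injective fun s : L →+* ℂ => (τ : ℂ →+* ℂ).comp s := by
    intro τ L _ s s' h
    refine RingHom.ext fun z => τ.injective ?_
    have h4 := RingHom.congr_fun h z
    simpa only [RingHom.coe_comp, RingHom.coe_coe, Function.comp_apply] using h4
  let permX : (ℂ ≃+* ℂ) → ((Σ i, (K i →+* ℂ)) ↪ (Σ i, (K i →+* ℂ))) := fun τ =>
    ⟨fun x => ⟨x.1, (τ : ℂ →+* ℂ).comp x.2⟩, by
      rintro ⟨i, φ⟩ ⟨j, ψ⟩ h
      obtain ⟨h1, h2⟩ := Sigma.mk.inj_iff.1 h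
      subst h1
      exact Sigma.ext rfl (heq_of_eq (hinjc τ (eq_of_heq h2)))⟩
  let permY : (ℂ ≃+* ℂ) → ((Σ j, (K' j →+* ℂ)) ↪ (Σ j, (K' j →+* ℂ))) := fun τ =>
    ⟨fun y => ⟨y.1, (τ : ℂ →+* ℂ).comp y.2⟩, by
      rintro ⟨i, φ⟩ ⟨j, ψ⟩ h
      obtain ⟨h1, h2⟩ := Sigma.mk.inj_iff.1 h
      subst h1
      exact Sigma.ext rfl (heq_of_eq (hinjc τ (eq_of_heq h2)))⟩
  let perm : (ℂ ≃+* ℂ) →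
      ((Σ i, (K i →+* ℂ)) ⊕ₗ (Σ j, (K' j →+* ℂ)) ↪ (Σ i, (K i →+* ℂ)) ⊕ₗ (Σ j, (K' j →+* ℂ))) := fun τ =>
    ((ofLex (α := (Σ i, (K i →+* ℂ)) ⊕ (Σ j, (K' j →+* ℂ)))).toEmbedding.trans ((permX τ).sumMap (permY τ))).trans
      (toLex (α := (Σ i, (K i →+* ℂ)) ⊕ (Σ j, (K' j →+* ℂ)))).toEmbedding
  have hsep : Function.Injective fun s : Set.powersetCard ((Σ i, (K i →+* ℂ)) ⊕ₗ (Σ j, (K' j →+* ℂ))) (2 * p) =>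
      ∏ z ∈ (s : Finset ((Σ i, (K i →+* ℂ)) ⊕ₗ (Σ j, (K' j →+* ℂ)))), ev z := by
    intro s t hst
    apply Subtype.ext
    have key : ∀ s : Finset ((Σ i, (K i →+* ℂ)) ⊕ₗ (Σ j, (K' j →+* ℂ))),
        ∏ z ∈ s, ev z = ∏ z ∈ s.map (ofLex (α := (Σ i, (K i →+* ℂ)) ⊕ (Σ j, (K' j →+* ℂ)))).toEmbedding,
          Sum.elim (fun x : (Σ i, (K i →+* ℂ)) => x.2 ((a x.1 : 𝓞 (K x.1)) : K x.1))
            (fun y : (Σ j, (K' j →+* ℂ)) => y.2 ((a' y.1 : 𝓞 (K' y.1)) : K' y.1)) z := by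
      intro s
      rw [Finset.prod_map]
      rfl
    have h2 : (s : Finset ((Σ i, (K i →+* ℂ)) ⊕ₗ (Σ j, (K' j →+* ℂ)))).map
          (ofLex (α := (Σ i, (K i →+* ℂ)) ⊕ (Σ j, (K' j →+* ℂ)))).toEmbedding =
        (t : Finset ((Σ i, (K i →+* ℂ)) ⊕ₗ (Σ j, (K' j →+* ℂ)))).map
          (ofLex (α := (Σ i, (K i →+* ℂ)) ⊕ (Σ j, (K' j →+* ℂ)))).toEmbedding := by
      apply haa
      have h3 : ∏ z ∈ (s : Finset ((Σ i, (K i →+* ℂ)) ⊕ₗ (Σ j, (K' j →+* ℂ)))), ev z =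
          ∏ z ∈ (t : Finset ((Σ i, (K i →+* ℂ)) ⊕ₗ (Σ j, (K' j →+* ℂ)))), ev z := hst
      rw [key, key] at h3
      exact h3
    exact Finset.map_injective _ h2
  have hperm : ∀ (τ : ℂ ≃+* ℂ) z, (τ : ℂ →+* ℂ) (ev z) = ev (perm τ z) := by
    intro τ z
    induction z using Lex.rec with
    | h z => rcases z with x | y <;> rfl
  -- (4) the `⊆` half on `X × Y`: `c` is a combination of balanced monomials `b s`
  have hc := mem_span_monomials_of_isRationalClass hZ hb P hv10 hv01 (RingHom.id ℂ) ev
    (AbelianVariety.prodMap (biproduct.map fun i => ι i (a i)) (biproduct.map fun j => ι' j (a' j))).hom.hom.hom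
    hf hsep (fun τ : ℂ ≃+* ℂ => (τ : ℂ →+* ℂ)) perm hperm (by omega : p + p = 2 * p) hcQ hcH'
  refine (Submodule.span_le.2 ?_) hc
  rintro _ ⟨s, hs, rfl⟩
  -- (5) the blocks of a balanced `s` are balanced
  obtain ⟨p₁, p₂, hp, hS₁, hS₂⟩ := hsplit
    ((s : Finset ((Σ i, (K i →+* ℂ)) ⊕ₗ (Σ j, (K' j →+* ℂ)))).map
      (ofLex (α := (Σ i, (K i →+* ℂ)) ⊕ (Σ j, (K' j →+* ℂ)))).toEmbedding) p (fun τ => by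
      obtain ⟨h1, h2⟩ := hs τ
      refine ⟨?_, ?_⟩
      · rw [ncard_sep_map_eq]
        refine Eq.trans (congrArg Set.ncard (Set.ext fun z => ?_)) h1
        induction z using Lex.rec with
        | h z => rcases z with x | y <;> exact Iff.rfl
      · rw [ncard_sep_map_eq]
        refine Eq.trans (congrArg Set.ncard (Set.ext fun z => ?_)) h2
        induction z using Lex.rec with
        | h z => rcases z with x | y <;> exact Iff.rfl)
  have hd : 2 * p₁ + 2 * p₂ = 2 * p := by omega
  obtain ⟨henum₁, henum₂⟩ := orderEmbOfFin_sumLex_castAdd_natAdd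
    (s : Finset ((Σ i, (K i →+* ℂ)) ⊕ₗ (Σ j, (K' j →+* ℂ)))) s.prop hS₁.1 hS₂.1 hd
  -- (6) monomial bases of the factors; `b s = pr_X^* b₁(s₁) ∪ pr_Y^* b₂(s₂)`
  obtain ⟨b₁, hb₁⟩ := exists_monomialBasis w (2 * p₁)
  obtain ⟨b₂, hb₂⟩ := exists_monomialBasis w' (2 * p₂)
  let s₁ : Set.powersetCard (Σ i, (K i →+* ℂ)) (2 * p₁) := Set.powersetCard.ofCard hS₁.1
  let s₂ : Set.powersetCard (Σ j, (K' j →+* ℂ)) (2 * p₂) := Set.powersetCard.ofCard hS₂.1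
  have hm₁ : cupPowOne ℂ (ComplexPoints ((⨁ A).prod (⨁ A')).X) (2 * p₁)
      (fun i => u ((Set.powersetCard.ofFinEmbEquiv.symm s) (Fin.cast hd (Fin.castAdd (2 * p₂) i)))) =
      complexBetti.map (AbelianVariety.fst (⨁ A) (⨁ A')).hom.hom.hom (2 * p₁) (b₁ s₁) := by
    rw [hb₁ s₁, Motives.complexBetti_map_cupPowOne]
    congr 1
    funext i
    rw [Set.powersetCard.ofFinEmbEquiv_symm_apply, Set.powersetCard.ofFinEmbEquiv_symm_apply,
      henum₁ i, hul]
    rfl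
  have hm₂ : cupPowOne ℂ (ComplexPoints ((⨁ A).prod (⨁ A')).X) (2 * p₂)
      (fun j => u ((Set.powersetCard.ofFinEmbEquiv.symm s) (Fin.cast hd (Fin.natAdd (2 * p₁) j)))) =
      complexBetti.map (AbelianVariety.snd (⨁ A) (⨁ A')).hom.hom.hom (2 * p₂) (b₂ s₂) := by
    rw [hb₂ s₂, Motives.complexBetti_map_cupPowOne]
    congr 1
    funext j
    rw [Set.powersetCard.ofFinEmbEquiv_symm_apply, Set.powersetCard.ofFinEmbEquiv_symm_apply,
      henum₂ j, hur]
    rfl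
  have hbs : b s = cupProduct hd
      (complexBetti.map (AbelianVariety.fst (⨁ A) (⨁ A')).hom.hom.hom (2 * p₁) (b₁ s₁))
      (complexBetti.map (AbelianVariety.snd (⨁ A) (⨁ A')).hom.hom.hom (2 * p₂) (b₂ s₂)) := by
    rw [hb s, cupPowOne_eq_cupProduct_split ℂ (2 * p₁) (2 * p₂) hd, hm₁, hm₂]
  -- (7) the block monomials are Hodge classes of the factors (Pohlmann's theorem for `X` and for `Y`)
  have hmem₁ : b₁ s₁ ∈ hodgeClassSpan (⨁ A).dim (⨁ A).X p₁ :=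
    weightClassesAlg_le_hodgeClassSpan hA hS₁
      (mem_weightClassesAlg_iff.2 fun c => map_monomial_eq_prod_smul hb₁ _ (hwθ c) s₁)
  have hmem₂ : b₂ s₂ ∈ hodgeClassSpan (⨁ A').dim (⨁ A').X p₂ :=
    weightClassesAlg_le_hodgeClassSpan hA' hS₂
      (mem_weightClassesAlg_iff.2 fun c => map_monomial_eq_prod_smul hb₂ _ (hwθ' c) s₂)
  -- (8) so `b s` is a combination of exterior products of rational Hodge classes
  rw [hbs]
  have h := cupProduct_map_map_mem_span hd
    (complexBetti.map (AbelianVariety.fst (⨁ A) (⨁ A')).hom.hom.hom (2 * p₁)).hom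
    (complexBetti.map (AbelianVariety.snd (⨁ A) (⨁ A')).hom.hom.hom (2 * p₂)).hom hmem₁ hmem₂
  refine Submodule.span_mono ?_ h
  rintro _ ⟨x, ⟨hxQ, hxH⟩, y, ⟨hyQ, hyH⟩, rfl⟩
  exact ⟨p₁, p₂, hd, x, y, hxQ, hxH, hyQ, hyH, rfl⟩

end Main

end Literature.AlgebraicGeometry.Pohlmann1968

end
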